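import Mathlib.GroupTheory.Nilpotent
import Mathlib.GroupTheory.QuotientGroup.Basic
import Mathlib.GroupTheory.Subgroup.Centralizer
import HarnessLib

/-!
# Generators of the commutator subgroup by left-normed commutators, and the kernel criterion of a rank-2 skeleton

builds on p205010 (kernel theorem, internal audit signed; external expert review pending) — nothing in this file uses p205010.
Lane `prim-bschramm`, seat `prim-bschramm-p4` gen 10 (PART C3, tier 2′ of `P4-GENERAL.md`).  Helper file
(`--supports stmt-CriticalPhenomena-4575 --as helper`).  Pure group theory.

For a group `G` generated by a symmetric set `A` let `W A k` be the left-normed commutators of weight `k + 1` in letters of `A`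
(`W A 0 = A`, `W A (k+1) = {⁅a, w⁆ : a ∈ A, w ∈ W A k}`) and `T A = ⋃ₖ W A (k+1)`.  Then
* `W A k ⊆ γ_k(G)` (`W_subset_lowerCentralSeries`), so in a nilpotent group only finitely many weights are non-trivial;
* `closure (T A)` is normal and contains the commutator subgroup (`commutator_le_closure_T`): the images of the generators commute
  modulo it;
* THE KERNEL CRITERION (`mem_closure_of_eq_zero`): if `φ : G → ℤ²` is additive, `x, y ∈ G` map to the two basis vectors, and every
  `a ∈ A` either lies in `ker φ` or is one of `x^{±1}, y^{±1}`, then `ker φ` is generated by `(A ∩ ker φ) ∪ T A`.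
This is the algebra behind the `ker_gen` field of `CayleyNeg₀ / CayleySign₀ / CylData` (cylinders of the skeleton are connected) for
free nilpotent groups of arbitrary class (sequel file `CayleyFreeNilpotentClass`).
-/

namespace Summit.CriticalPhenomena.PercolationContinuityZ3.Theorems.Transplant

namespace KerGen

open Subgroup
open scoped commutatorElement

variable {G : Type*} [Group G]

/-! ## §1 Left-normed commutators -/

/-- Left-normed commutators of weight `k + 1` in letters of `A`: `W A 0 = A`, `W A (k+1) = {⁅a, w⁆ : a ∈ A, w ∈ W A k}`. [folklore] -/
def W (A : Set G) : ℕ → Set G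
  | 0 => A
  | k + 1 => Set.image2 (fun a w => ⁅a, w⁆) A (W A k)

/-- All left-normed commutators of weight `≥ 2`. [folklore] -/
def T (A : Set G) : Set G := ⋃ k, W A (k + 1)

/-- Unfolding `W A 0`. [folklore] -/
theorem W_zero (A : Set G) : W A 0 = A := rfl

/-- Unfolding `W A (k+1)`. [folklore] -/
theorem W_succ (A : Set G) (k : ℕ) : W A (k + 1) = Set.image2 (fun a w => ⁅a, w⁆) A (W A k) := rfl

/-- `⁅a, w⁆ ∈ W A (k+1)` for `a ∈ A`, `w ∈ W A k`. [folklore] -/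
theorem commutator_mem_W {A : Set G} {k : ℕ} {a w : G} (ha : a ∈ A) (hw : w ∈ W A k) : ⁅a, w⁆ ∈ W A (k + 1) :=
  Set.mem_image2_of_mem ha hw

/-- `W A (k+1) ⊆ T A`. [folklore] -/
theorem W_succ_subset_T (A : Set G) (k : ℕ) : W A (k + 1) ⊆ T A := Set.subset_iUnion (fun k => W A (k + 1)) k

/-- `T A` is closed under `⁅a, ·⁆` for `a ∈ A`. [folklore] -/
theorem commutator_mem_T {A : Set G} {a t : G} (ha : a ∈ A) (ht : t ∈ T A) : ⁅a, t⁆ ∈ T A := by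
  obtain ⟨k, hk⟩ := Set.mem_iUnion.1 ht
  exact Set.mem_iUnion.2 ⟨k + 1, commutator_mem_W ha hk⟩

/-- An element of `T A` is a commutator `⁅a, w⁆` with `a ∈ A`. [folklore] -/
theorem exists_eq_commutator_of_mem_T {A : Set G} {t : G} (ht : t ∈ T A) : ∃ a ∈ A, ∃ w : G, t = ⁅a, w⁆ := by
  obtain ⟨k, hk⟩ := Set.mem_iUnion.1 ht
  obtain ⟨a, ha, w, -, rfl⟩ := hk
  exact ⟨a, ha, w, rfl⟩

/-- **`W A k ⊆ γ_k(G)`**: a left-normed commutator of weight `k + 1` lies in the `k`-th term of the lower central series. [folklore] -/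
theorem W_subset_lowerCentralSeries (A : Set G) :
    ∀ k, W A k ⊆ ((⊤ : Subgroup G).lowerCentralSeries k : Set G)
  | 0 => fun _ _ => Subgroup.mem_top _
  | k + 1 => by
      rintro _ ⟨a, -, w, hw, rfl⟩
      have hw' : w ∈ (⊤ : Subgroup G).lowerCentralSeries k := W_subset_lowerCentralSeries A k hw
      change ⁅a, w⁆ ∈ (⊤ : Subgroup G).lowerCentralSeries (k + 1)
      rw [Subgroup.lowerCentralSeries_succ, ← commutatorElement_inv, inv_mem_iff]
      exact Subgroup.commutator_mem_commutator hw' (Subgroup.mem_top a)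

/-- In a group of class `≤ c` (`γ_c(G) = 1`) the left-normed commutators of weight `> c` are trivial. [folklore] -/
theorem W_eq_one_of_lowerCentralSeries_eq_bot {A : Set G} {c k : ℕ} (hc : (⊤ : Subgroup G).lowerCentralSeries c = ⊥) (hk : c ≤ k)
    {w : G} (hw : w ∈ W A k) : w = 1 := by
  have h := (Subgroup.lowerCentralSeries_antitone (⊤ : Subgroup G) hk) (W_subset_lowerCentralSeries A k hw)
  rwa [hc, Subgroup.mem_bot] at h

/-- A homomorphism maps `W A k` onto `W (f '' A) k`. [folklore] -/
theorem image_W {H : Type*} [Group H] (f : G →* H) (A : Set G) : ∀ k, f '' W A k = W (f '' A) k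
  | 0 => rfl
  | k + 1 => by
      rw [W_succ, W_succ, Set.image_image2, ← image_W f A k, Set.image2_image_left, Set.image2_image_right]
      simp only [map_commutatorElement]

/-- A homomorphism maps `T A` onto `T (f '' A)`. [folklore] -/
theorem image_T {H : Type*} [Group H] (f : G →* H) (A : Set G) : f '' T A = T (f '' A) := by
  simp only [T, Set.image_iUnion, image_W]

/-! ## §2 The closure of `T A` is normal and contains the commutator subgroup -/

/-- Conjugating an element of `closure (T A)` by a letter of `A` stays in `closure (T A)`: `a t a⁻¹ = ⁅a, t⁆ t`. [folklore] -/
theorem conj_mem_closure_T {A : Set G} {a : G} (ha : a ∈ A) {c : G} (hc : c ∈ closure (T A)) :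
    a * c * a⁻¹ ∈ closure (T A) := by
  induction hc using Subgroup.closure_induction with
  | mem t ht =>
      have h : a * t * a⁻¹ = ⁅a, t⁆ * t := by rw [commutatorElement_def]; group
      rw [h]; exact mul_mem (subset_closure (commutator_mem_T ha ht)) (subset_closure ht)
  | one => simp
  | mul u v _ _ hu hv =>
      have h : a * (u * v) * a⁻¹ = (a * u * a⁻¹) * (a * v * a⁻¹) := by group
      rw [h]; exact mul_mem hu hv
  | inv u _ hu =>
      have h : a * u⁻¹ * a⁻¹ = (a * u * a⁻¹)⁻¹ := by group
      rw [h]; exact inv_mem hu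

/-- Two-sided conjugation invariance of `closure (T A)` under every element of `G = ⟨A⟩` (`A` symmetric). [folklore] -/
theorem conj_mem_closure_T_of_mem_closure {A : Set G} (hsymm : ∀ a ∈ A, a⁻¹ ∈ A) {g : G} (hg : g ∈ closure A) :
    ∀ c ∈ closure (T A), g * c * g⁻¹ ∈ closure (T A) ∧ g⁻¹ * c * g ∈ closure (T A) := by
  induction hg using Subgroup.closure_induction with
  | mem a ha =>
      intro c hc
      exact ⟨conj_mem_closure_T ha hc, by simpa only [inv_inv] using conj_mem_closure_T (hsymm a ha) hc⟩
  | one => intro c hc; simpa using hc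
  | mul u v _ _ hu hv =>
      intro c hc
      refine ⟨?_, ?_⟩
      · have h : u * v * c * (u * v)⁻¹ = u * (v * c * v⁻¹) * u⁻¹ := by group
        rw [h]; exact (hu _ (hv _ hc).1).1
      · have h : (u * v)⁻¹ * c * (u * v) = v⁻¹ * (u⁻¹ * c * u) * v := by group
        rw [h]; exact (hv _ (hu _ hc).2).2
  | inv u _ hu => intro c hc; simpa only [inv_inv] using (hu c hc).symm

/-- **`closure (T A)` is a normal subgroup** when `A` is a symmetric generating set. [folklore] -/
theorem closure_T_normal {A : Set G} (hA : closure A = ⊤) (hsymm : ∀ a ∈ A, a⁻¹ ∈ A) : (closure (T A)).Normal :=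
  ⟨fun c hc g => (conj_mem_closure_T_of_mem_closure hsymm (by rw [hA]; exact mem_top g) c hc).1⟩

/-- In the quotient by a normal subgroup containing `⁅a, b⁆` for all letters `a, b ∈ A` of a generating set, everything commutes.
[folklore] -/
theorem mk_mul_comm_of_generators {A : Set G} (hA : closure A = ⊤) (N : Subgroup G) [N.Normal]
    (hN : ∀ a ∈ A, ∀ b ∈ A, ⁅a, b⁆ ∈ N) (u v : G) : (u : G ⧸ N) * v = v * u := by
  set s : Set (G ⧸ N) := QuotientGroup.mk' N '' A with hs
  have hcomm : ∀ p ∈ s, ∀ q ∈ s, p * q = q * p := by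
    rintro _ ⟨a, ha, rfl⟩ _ ⟨b, hb, rfl⟩
    have h2 : ⁅QuotientGroup.mk' N a, QuotientGroup.mk' N b⁆ = 1 := by
      rw [← map_commutatorElement]; exact (QuotientGroup.eq_one_iff _).2 (hN a ha b hb)
    exact (commutatorElement_eq_one_iff_commute.1 h2).eq
  have htop : closure s = ⊤ := by
    rw [hs, ← MonoidHom.map_closure, hA, ← MonoidHom.range_eq_map, QuotientGroup.range_mk']
  have hcen : closure s ≤ centralizer s := by
    rw [Subgroup.closure_le]
    intro p hp
    exact Subgroup.mem_centralizer_iff.2 fun q hq => (hcomm p hp q hq).symm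
  have hu : (u : G ⧸ N) ∈ centralizer s := hcen (by rw [htop]; exact mem_top _)
  have hv : (v : G ⧸ N) ∈ centralizer (centralizer s : Set (G ⧸ N)) :=
    closure_le_centralizer_centralizer s (by rw [htop]; exact mem_top _)
  exact Subgroup.mem_centralizer_iff.1 hv _ hu

/-- **The commutator subgroup is generated, as a subgroup, by the left-normed commutators of the generators**:
`commutator G ≤ closure (T A)` for a symmetric generating set `A`. [folklore] -/
theorem commutator_le_closure_T {A : Set G} (hA : closure A = ⊤) (hsymm : ∀ a ∈ A, a⁻¹ ∈ A) :
    commutator G ≤ closure (T A) := by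
  haveI := closure_T_normal hA hsymm
  have hgen : ∀ a ∈ A, ∀ b ∈ A, ⁅a, b⁆ ∈ closure (T A) := fun a ha b hb =>
    subset_closure (W_succ_subset_T A 0 (commutator_mem_W (k := 0) ha hb))
  rw [_root_.commutator_def, Subgroup.commutator_le]
  intro u _ v _
  have h : ⁅QuotientGroup.mk' (closure (T A)) u, QuotientGroup.mk' (closure (T A)) v⁆ = 1 :=
    commutatorElement_eq_one_iff_commute.2 (mk_mul_comm_of_generators hA _ hgen u v)
  rw [← map_commutatorElement] at h
  exact (QuotientGroup.eq_one_iff _).1 h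

/-! ## §3 The kernel criterion of a rank-2 skeleton -/

section Kernel

variable {A : Set G} (φ : G → (Fin 2 → ℤ)) (hφ : ∀ g h, φ (g * h) = φ g + φ h)
include hφ

/-- `φ 1 = 0`. [folklore] -/
theorem phi_one : φ 1 = 0 := by
  have h := hφ 1 1; rw [one_mul] at h; exact left_eq_add.1 h

/-- `φ g⁻¹ = −φ g`. [folklore] -/
theorem phi_inv (g : G) : φ g⁻¹ = -φ g := by
  have h := hφ g g⁻¹; rw [mul_inv_cancel, phi_one φ hφ] at h
  exact (neg_eq_of_add_eq_zero_right h.symm).symm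

/-- `φ ⁅a, b⁆ = 0`. [folklore] -/
theorem phi_commutatorElement (a b : G) : φ ⁅a, b⁆ = 0 := by
  rw [commutatorElement_def, hφ, hφ, hφ, phi_inv φ hφ, phi_inv φ hφ]; abel

/-- `φ (x ^ i) = i • φ x` for `i : ℤ`. [folklore] -/
theorem phi_zpow (x : G) (i : ℤ) : φ (x ^ i) = i • φ x := by
  let Φ : G →* Multiplicative (Fin 2 → ℤ) :=
    MonoidHom.mk' (fun g => Multiplicative.ofAdd (φ g)) (fun a b => by rw [hφ, ofAdd_add])
  have h : Φ (x ^ i) = (Φ x) ^ i := map_zpow Φ x i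
  have h' : Multiplicative.toAdd (Φ (x ^ i)) = Multiplicative.toAdd ((Φ x) ^ i) := by rw [h]
  simpa [Φ] using h'

/-- `φ` vanishes on `closure ((A ∩ ker φ) ∪ T A)`. [folklore] -/
theorem phi_eq_zero_of_mem_closure {g : G} (hg : g ∈ closure ({a | a ∈ A ∧ φ a = 0} ∪ T A)) : φ g = 0 := by
  induction hg using Subgroup.closure_induction with
  | mem t ht =>
      rcases ht with ⟨-, h⟩ | ht
      · exact h
      · obtain ⟨a, -, w, rfl⟩ := exists_eq_commutator_of_mem_T ht
        exact phi_commutatorElement φ hφ a w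
  | one => exact phi_one φ hφ
  | mul u v _ _ hu hv => rw [hφ, hu, hv, add_zero]
  | inv u _ hu => rw [phi_inv φ hφ, hu, neg_zero]

omit hφ in
/-- Every element is `x^i y^j` modulo `P = closure ((A ∩ ker φ) ∪ T A)` when every letter is in `ker φ` or among `x^{±1}, y^{±1}`.
[folklore] -/
theorem exists_zpow_mul_zpow_mem (hA : closure A = ⊤) (hsymm : ∀ a ∈ A, a⁻¹ ∈ A) {x y : G}
    (hAφ : ∀ a ∈ A, φ a = 0 ∨ a = x ∨ a = x⁻¹ ∨ a = y ∨ a = y⁻¹) (g : G) :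
    ∃ i j : ℤ, (x ^ i * y ^ j)⁻¹ * g ∈ closure ({a | a ∈ A ∧ φ a = 0} ∪ T A) := by
  set P := closure ({a | a ∈ A ∧ φ a = 0} ∪ T A) with hP
  have hTP : closure (T A) ≤ P := closure_mono Set.subset_union_right
  have hcomm : commutator G ≤ P := (commutator_le_closure_T hA hsymm).trans hTP
  haveI hN : Subgroup.Normal P := by
    refine ⟨fun p hp g' => ?_⟩
    have h : g' * p * g'⁻¹ = ⁅g', p⁆ * p := by rw [commutatorElement_def]; group
    rw [h]
    exact mul_mem (hcomm (by rw [_root_.commutator_def]; exact Subgroup.commutator_mem_commutator (mem_top g') (mem_top p))) hp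
  -- the quotient is commutative
  have hq : ∀ u v : G, (u : G ⧸ P) * v = v * u := mk_mul_comm_of_generators hA P (fun a _ b _ =>
    hcomm (by rw [_root_.commutator_def]; exact Subgroup.commutator_mem_commutator (mem_top a) (mem_top b)))
  -- restate membership as an equation in the quotient
  have key : ∀ g : G, ∀ i j : ℤ, ((x ^ i * y ^ j)⁻¹ * g ∈ P ↔ ((x ^ i * y ^ j : G) : G ⧸ P) = g) := fun g i j =>
    (QuotientGroup.eq (s := P)).symm
  have hg : g ∈ closure A := by rw [hA]; exact mem_top g
  induction hg using Subgroup.closure_induction with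
  | mem a ha =>
      rcases hAφ a ha with h | rfl | rfl | rfl | rfl
      · have ha' : a ∈ ({a | a ∈ A ∧ φ a = 0} ∪ T A : Set G) := Or.inl ⟨ha, h⟩
        exact ⟨0, 0, by simpa using subset_closure ha'⟩
      · exact ⟨1, 0, by simp [one_mem]⟩
      · exact ⟨-1, 0, by simp [one_mem]⟩
      · exact ⟨0, 1, by simp [one_mem]⟩
      · exact ⟨0, -1, by simp [one_mem]⟩
  | one => exact ⟨0, 0, by simp [one_mem]⟩
  | mul u v _ _ hu hv =>
      obtain ⟨i, j, hu⟩ := hu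
      obtain ⟨k, l, hv⟩ := hv
      refine ⟨i + k, j + l, ?_⟩
      rw [key] at hu hv ⊢
      rw [QuotientGroup.mk_mul P u v, ← hu, ← hv]
      simp only [QuotientGroup.mk_mul, QuotientGroup.mk_zpow, zpow_add]
      have h2 : (x : G ⧸ P) ^ k * (y : G ⧸ P) ^ j = (y : G ⧸ P) ^ j * (x : G ⧸ P) ^ k := by
        simpa only [QuotientGroup.mk_zpow] using hq (x ^ k) (y ^ j)
      rw [mul_assoc, mul_assoc, ← mul_assoc ((x : G ⧸ P) ^ k), h2, mul_assoc]
  | inv u _ hu =>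
      obtain ⟨i, j, hu⟩ := hu
      refine ⟨-i, -j, ?_⟩
      rw [key] at hu ⊢
      rw [QuotientGroup.mk_inv, ← hu]
      simp only [QuotientGroup.mk_mul, QuotientGroup.mk_zpow, mul_inv_rev, zpow_neg]
      have := hq ((x : G) ^ i)⁻¹ ((y : G) ^ j)⁻¹
      simpa only [QuotientGroup.mk_inv, QuotientGroup.mk_zpow] using this

/-- **THE KERNEL CRITERION.**  Let `A` be a symmetric generating set of `G`, `φ : G → ℤ²` additive, `x, y ∈ G` with `φ x = e₀`,
`φ y = e₁`, and suppose every letter of `A` lies in `ker φ` or is one of `x^{±1}, y^{±1}`.  Then every `g ∈ ker φ` lies in the subgroup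
generated by `(A ∩ ker φ) ∪ T A` (the kernel letters and the left-normed commutators of letters). [folklore] -/
theorem mem_closure_of_eq_zero (hA : closure A = ⊤) (hsymm : ∀ a ∈ A, a⁻¹ ∈ A) {x y : G}
    (hx : φ x = Pi.single 0 1) (hy : φ y = Pi.single 1 1)
    (hAφ : ∀ a ∈ A, φ a = 0 ∨ a = x ∨ a = x⁻¹ ∨ a = y ∨ a = y⁻¹) {g : G} (hg : φ g = 0) :
    g ∈ closure ({a | a ∈ A ∧ φ a = 0} ∪ T A) := by
  obtain ⟨i, j, h⟩ := exists_zpow_mul_zpow_mem φ hA hsymm hAφ g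
  have h0 := phi_eq_zero_of_mem_closure φ hφ h
  rw [hφ, phi_inv φ hφ, hφ, phi_zpow φ hφ, phi_zpow φ hφ, hx, hy, hg, add_zero, neg_eq_zero] at h0
  have hi : i = 0 := by simpa using congr_fun h0 0
  have hj : j = 0 := by simpa using congr_fun h0 1
  subst hi; subst hj
  simpa using h

end Kernel

end KerGen

end Summit.CriticalPhenomena.PercolationContinuityZ3.Theorems.Transplant
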